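import Summits.BirchSwinnertonDyer.BirchSwinnertonDyer.Theorems.SemiOrdinaryEisensteinDescentWildSplitEisensteinInclusionAtThreeStubSaturate
import Literature.NumberTheory.EllipticCurves.UnrIntegersUnits
import HarnessLib

/-!
# Route `CumulativeHeegnerLeopoldt`, crux K1 `CumulativeHeegnerInclusionAtThree` (stmt-BirchSwinnertonDyer-24198),
# line `birth`, registered STUB C `stub_threeSaturation`: SATURATION AT THE PRIME `3` OF `R₀⟦T⟧`

Pure algebra in `Λ_{R₀} = R₀⟦T⟧ = UnrSeries 3` (`R₀ = unrIntegers 3 ⊂ ℂ₃`, Castella's `W(𝔽̄₃)^∧`); no elliptic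
curve enters. If `g ∈ R₀⟦T⟧` has a coefficient of norm `1` (a unit of `R₀`,
`unrIntegers.isUnit_iff_norm_eq_one`) and `(3^μ · L) ⊆ (g)`, then `(L) ⊆ (g)`: `3` is prime in the DVR `R₀`, so
`R₀⟦T⟧/(3) = (R₀/3)⟦T⟧` is a domain in which `g ≠ 0`, and the powers of `3` cancel one at a time — this is the
SemiOrdinaryEisensteinDescent stub `stub_saturate` (seat bsd-wall-utd-p3, file
`…WildSplitEisensteinInclusionAtThreeStubSaturate.lean`, theorem `mem_span_of_pow_three_mul_mem_span`), CITED here,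
not re-proved. In the line `birth` of K1 it upgrades the TEMPERED inclusion `span(3^μ·L) ⊆ Ch·R₀⟦T⟧` (stub A) to
the integral inclusion once `Ch·R₀⟦T⟧ = (g)` has `μ = 0` (stub B). Seat bsd-line-chl-p1 g0 (lead prover),
`--supports stmt-BirchSwinnertonDyer-24198`. No definition, no named fact, no `sorry`; BSD is not proved by any
of this.

References: [Washington1997] §7.1 (structure of `𝒪⟦T⟧`, `p` prime in `Λ`); [Castella2018] §3 (the receptacle
`R₀⟦T⟧`).
-/

set_option autoImplicit false
set_option linter.dupNamespace false

noncomputable section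

open scoped Classical

namespace Summit.BirchSwinnertonDyer.BirchSwinnertonDyer.Theorems.CumulativeHeegnerInclusionAtThreeSaturation

open PowerSeries Literature.NumberTheory.EllipticCurves
  Summit.BirchSwinnertonDyer.BirchSwinnertonDyer.Theorems.WildSplitEisensteinInclusionAtThreeSaturate

/-- **Saturation at `3` in `R₀⟦T⟧`, principal-ideal form.** If `g` has a coefficient of norm `1` and
`(3^μ · L) ⊆ (g)`, then `(L) ⊆ (g)` (the norm-one coefficient is a unit of `R₀`, and
`mem_span_of_pow_three_mul_mem_span` cancels the `3`-power in the domain `(R₀/3)⟦T⟧`). [folklore] -/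
theorem span_le_span_of_span_pow_three_mul_le (L g : UnrSeries 3) (μ n : ℕ)
    (hn : ‖((PowerSeries.coeff n g : unrIntegers 3) : ℂ_[3])‖ = 1)
    (hle : Ideal.span {(3 : UnrSeries 3) ^ μ * L} ≤ Ideal.span {g}) :
    Ideal.span {L} ≤ Ideal.span {g} := by
  have hunit : ∃ m : ℕ, IsUnit (PowerSeries.coeff m g) :=
    ⟨n, (unrIntegers.isUnit_iff_norm_eq_one _).mpr hn⟩
  have hmem : (3 : UnrSeries 3) ^ μ * L ∈ Ideal.span {g} := hle (Ideal.mem_span_singleton_self _)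
  exact (Ideal.span_singleton_le_iff_mem _).mpr (mem_span_of_pow_three_mul_mem_span g hunit μ L hmem)

/-- **Registered STUB C `stub_threeSaturation` of line `birth` of crux K1 `CumulativeHeegnerInclusionAtThree`
(stmt-BirchSwinnertonDyer-24198), signature VERBATIM**: for `L g ∈ R₀⟦T⟧` and `μ n : ℕ`, if `‖g_n‖ = 1` and
`(3^μ · L) ⊆ (g)` then `(L) ⊆ (g)`. [folklore] -/
theorem stub_threeSaturation :
    ∀ (L g : Literature.NumberTheory.EllipticCurves.UnrSeries 3) (μ n : ℕ), ‖((PowerSeries.coeff n g : Literature.NumberTheory.EllipticCurves.unrIntegers 3) : ℂ_[3])‖ = 1 → Ideal.span {(3 : Literature.NumberTheory.EllipticCurves.UnrSeries 3) ^ μ * L} ≤ Ideal.span {g} → Ideal.span {L} ≤ Ideal.span {g} :=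
  fun L g μ n hn hle ↦ span_le_span_of_span_pow_three_mul_le L g μ n hn hle

end Summit.BirchSwinnertonDyer.BirchSwinnertonDyer.Theorems.CumulativeHeegnerInclusionAtThreeSaturation

end
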